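import Literature.NumberTheory.Sieve.ParityBarrier
import Literature.NumberTheory.Sieve.PrimePowersInProgressions
import HarnessLib

/-!
# The two vendored forms of the Elliott–Halberstam conjecture agree

`Literature/NumberTheory/Sieve/ParityBarrier.lean` records as a named fact
(`Literature.NumberTheory.Sieve.elliottHalberstam_iff_wave0`) that the prelude form of the Elliott–Halberstam conjecture,
`Literature.ElliottHalberstam = ∀ θ < 1, PrimesHaveLevel θ` — Bombieri–Vinogradov shape: for all `A > 0` and
`ε > 0`, `∑_{q ≤ x^{θ−ε}} max_{1 ≤ y ≤ x} max_{(a,q)=1} |ψ(y; q, a) − y/φ(q)| ≪ x (log x)^{−A}` — is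
equivalent to the Wave0 form `Literature.Parity.ElliottHalberstamConjecture = ∀ θ < 1, EH θ` (parity.S25:
for all real `A`, `∑_{q ≤ x^θ} max_{(a,q)=1} |ψ(x; q, a) − x/φ(q)| ≪ x (log x)^{−A}`; no maximum over
`y`, level exactly `x^θ`).  This file proves it: `Literature.NumberTheory.Sieve.elliottHalberstam_iff_wave0_holds`.

* `→` (`Literature.NumberTheory.Sieve.LevelOfDistribution.ElliottHalberstam.eh`): for `θ < 1` apply `PrimesHaveLevel θ₁` with `θ₁ = (θ + 1)/2`,
  `ε = θ₁ − θ` and `A' = max A 1`; the Wave0 summand at `q` is the `y = x` term of the supremum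
  `E*(x; q) = primeAPError x q`, and `x (log x)^{−A'} ≤ x (log x)^{−A}` once `log x ≥ 1`.
* `←` (`Literature.NumberTheory.Sieve.primesHaveLevel_of_forall_eh`): given `θ < 1`, `A > 0`, `ε > 0`, put `η = θ − ε`,
  `θ' = max ((θ+1)/2) (1/2) ∈ (η, 1)`, `B = A + 2`, `Y = Δ = x (log x)^{−B}` and the grid
  `y_i = min (x, (i + 1) Y)`, `0 ≤ i ≤ J = ⌈(log x)^B⌉`.  Since `ψ(·; q, a)` is nondecreasing and
  nonnegative, for `1 ≤ y ≤ Y` one has `|ψ(y; q, a) − y/φ(q)| ≤ |ψ(Y; q, a) − Y/φ(q)| + 2Y/φ(q)`, and for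
  `y ∈ [y_i, y_{i+1}]` the discrepancy at `y` is within `Δ/φ(q)` of the one at `y_i` or `y_{i+1}`
  (`abs_chebyshevPsiMod_sub_div_le_sum_grid`).  Hence
  `E*(x; q) ≤ ∑_{i ≤ J} max_a |ψ(y_i; q, a) − y_i/φ(q)| + 3Y/φ(q)`; summing over `q ≤ x^η ≤ y_i^{θ'}`
  and applying `EH θ'` with exponent `A + B` at each of the `J + 1 ≤ 3 (log x)^B` grid points
  (all `≥ Y`, where `log Y ≥ (log x)/2`), together with `∑_{q ≤ Q} 1/φ(q) ≤ (1 + log Q)²`, gives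
  `≪ x (log x)^{−A}`.  This is the routine equivalence of the "`max_{y ≤ x}`" and "`y = x`" forms of
  the level of distribution (Iwaniec–Kowalski, *Analytic Number Theory*, §17.1, discussion of (17.3)–(17.5);
  the grid argument is the standard device, cf. the proof of Thm 17.1 there).

## References

* H. Iwaniec, E. Kowalski, *Analytic Number Theory*, AMS Colloquium Publ. 53 (2004), §17.1.
  [cite: IwaniecKowalski2004]
* P. D. T. A. Elliott, H. Halberstam, *A conjecture in prime number theory*, Symposia Mathematica IV
  (INDAM, Rome, 1968/69), 59–72. [cite: ElliottHalberstam1970]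
-/

open Filter Asymptotics Finset

namespace Literature.NumberTheory.Sieve

/-! ### Elementary facts on `ψ(y; q, a)` -/

/-- `ψ(y; q, a) ≥ 0`. [folklore] -/
theorem chebyshevPsiMod_nonneg (q : ℕ) (a : ZMod q) (y : ℝ) : 0 ≤ LevelOfDistribution.chebyshevPsiMod q a y :=
  Finset.sum_nonneg fun n _ => ArithmeticFunction.vonMangoldt.residueClass_nonneg a n

/-- `ψ(·; q, a)` is nondecreasing. [folklore] -/
theorem chebyshevPsiMod_mono (q : ℕ) (a : ZMod q) {y y' : ℝ} (h : y ≤ y') :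
    LevelOfDistribution.chebyshevPsiMod q a y ≤ LevelOfDistribution.chebyshevPsiMod q a y' :=
  Finset.sum_le_sum_of_subset_of_nonneg
    (Finset.range_mono (Nat.succ_le_succ (Nat.floor_le_floor h)))
    fun n _ _ => ArithmeticFunction.vonMangoldt.residueClass_nonneg a n

/-- **Grid interpolation for the discrepancy `ψ(y; q, a) − y/φ`.** Let `0 ≤ Y`, `0 ≤ Δ`, `0 < φ` and let
`g 0 = Y ≤ g 1 ≤ ⋯ ≤ g J = x` be a grid with steps `≤ Δ`. Then for every `0 ≤ y ≤ x`,
`|ψ(y; q, a) − y/φ| ≤ ∑_{i ≤ J} |ψ(g i; q, a) − (g i)/φ| + (2Y + Δ)/φ`: for `y ≤ Y` both `ψ(y; q, a)`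
and `y/φ` are at most their values at `Y`; for `g i ≤ y ≤ g (i+1)` monotonicity of `ψ` pins the
discrepancy at `y` between the discrepancies at the two neighbouring grid points up to `Δ/φ`.
[folklore] -/
theorem abs_chebyshevPsiMod_sub_div_le_sum_grid {q : ℕ} (a : ZMod q) {x Y Δ φ : ℝ} (hφ : 0 < φ)
    (hY : 0 ≤ Y) (hΔ : 0 ≤ Δ) (g : ℕ → ℝ) (J : ℕ) (hg0 : g 0 = Y) (hgJ : g J = x)
    (hstep : ∀ i < J, g i ≤ g (i + 1) ∧ g (i + 1) - g i ≤ Δ) {y : ℝ} (hy0 : 0 ≤ y) (hyx : y ≤ x) :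
    |LevelOfDistribution.chebyshevPsiMod q a y - y / φ| ≤
      ∑ i ∈ range (J + 1), |LevelOfDistribution.chebyshevPsiMod q a (g i) - g i / φ| + (2 * Y + Δ) / φ := by
  have hnn : ∀ i ∈ range (J + 1), 0 ≤ |LevelOfDistribution.chebyshevPsiMod q a (g i) - g i / φ| :=
    fun i _ => abs_nonneg _
  rcases le_or_gt y Y with hyY | hYy
  · -- small `y`: compare with the grid point `g 0 = Y`
    have h1 : LevelOfDistribution.chebyshevPsiMod q a y ≤ LevelOfDistribution.chebyshevPsiMod q a Y := chebyshevPsiMod_mono q a hyY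
    have h2 : y / φ ≤ Y / φ := div_le_div_of_nonneg_right hyY hφ.le
    have h3 : 0 ≤ y / φ := div_nonneg hy0 hφ.le
    have h4 : 0 ≤ LevelOfDistribution.chebyshevPsiMod q a y := chebyshevPsiMod_nonneg q a y
    have h5 : |LevelOfDistribution.chebyshevPsiMod q a (g 0) - g 0 / φ| ≤
        ∑ i ∈ range (J + 1), |LevelOfDistribution.chebyshevPsiMod q a (g i) - g i / φ| :=
      Finset.single_le_sum hnn (Finset.mem_range.2 (Nat.succ_pos J))
    rw [hg0] at h5
    have h6 : LevelOfDistribution.chebyshevPsiMod q a Y - Y / φ ≤ |LevelOfDistribution.chebyshevPsiMod q a Y - Y / φ| := le_abs_self _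
    have h7 : (2 * Y + Δ) / φ = 2 * (Y / φ) + Δ / φ := by ring
    have h8 : 0 ≤ Δ / φ := div_nonneg hΔ hφ.le
    rw [abs_le]
    constructor <;> nlinarith
  · -- `Y < y ≤ x`: locate `y` in a grid cell `[g i, g (i+1)]`, `i < J`
    have hJ : 0 < J := by
      rcases Nat.eq_zero_or_pos J with rfl | h
      · rw [hg0] at hgJ; linarith
      · exact h
    have hex : ∃ i, y ≤ g (i + 1) := ⟨J - 1, by rw [Nat.sub_add_cancel hJ, hgJ]; exact hyx⟩
    classical
    set i := Nat.find hex with hi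
    have hiy : y ≤ g (i + 1) := Nat.find_spec hex
    have hiJ : i < J := by
      have : i ≤ J - 1 := Nat.find_min' hex (by rw [Nat.sub_add_cancel hJ, hgJ]; exact hyx)
      omega
    have hgi : g i ≤ y := by
      rcases Nat.eq_zero_or_pos i with h0 | hpos
      · rw [h0, hg0]; exact hYy.le
      · have := Nat.find_min hex (m := i - 1) (by omega)
        rw [Nat.sub_add_cancel hpos] at this
        exact (not_le.1 this).le
    obtain ⟨-, hst⟩ := hstep i hiJ
    -- upper bound through `g (i+1)`, lower bound through `g i`
    have hu1 : LevelOfDistribution.chebyshevPsiMod q a y ≤ LevelOfDistribution.chebyshevPsiMod q a (g (i + 1)) := chebyshevPsiMod_mono q a hiy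
    have hl1 : LevelOfDistribution.chebyshevPsiMod q a (g i) ≤ LevelOfDistribution.chebyshevPsiMod q a y := chebyshevPsiMod_mono q a hgi
    have hu2 : g (i + 1) / φ - y / φ ≤ Δ / φ := by
      rw [← sub_div]; exact div_le_div_of_nonneg_right (by linarith) hφ.le
    have hl2 : y / φ - g i / φ ≤ Δ / φ := by
      rw [← sub_div]; exact div_le_div_of_nonneg_right (by linarith) hφ.le
    have hmem1 : i + 1 ∈ range (J + 1) := Finset.mem_range.2 (by omega)
    have hmem0 : i ∈ range (J + 1) := Finset.mem_range.2 (by omega)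
    have hs1 : |LevelOfDistribution.chebyshevPsiMod q a (g (i + 1)) - g (i + 1) / φ| ≤
        ∑ i ∈ range (J + 1), |LevelOfDistribution.chebyshevPsiMod q a (g i) - g i / φ| := Finset.single_le_sum hnn hmem1
    have hs0 : |LevelOfDistribution.chebyshevPsiMod q a (g i) - g i / φ| ≤
        ∑ i ∈ range (J + 1), |LevelOfDistribution.chebyshevPsiMod q a (g i) - g i / φ| := Finset.single_le_sum hnn hmem0
    have ha1 := le_abs_self (LevelOfDistribution.chebyshevPsiMod q a (g (i + 1)) - g (i + 1) / φ)
    have ha0 := neg_abs_le (LevelOfDistribution.chebyshevPsiMod q a (g i) - g i / φ)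
    have hY2 : 0 ≤ 2 * Y / φ := div_nonneg (by linarith) hφ.le
    have h7 : (2 * Y + Δ) / φ = 2 * Y / φ + Δ / φ := by ring
    rw [abs_le, h7]
    constructor <;> linarith

/-- The supremum form: with a grid as in `abs_chebyshevPsiMod_sub_div_le_sum_grid` (and `1 ≤ x`),
`E*(x; q) ≤ ∑_{i ≤ J} max_{(a,q)=1} |ψ(g i; q, a) − (g i)/φ(q)| + (2Y + Δ)/φ(q)`. [folklore] -/
theorem primeAPError_le_sum_grid {q : ℕ} (hq : q ≠ 0) {x Y Δ : ℝ} (hx : 1 ≤ x) (hY : 0 ≤ Y)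
    (hΔ : 0 ≤ Δ) (g : ℕ → ℝ) (J : ℕ) (hg0 : g 0 = Y) (hgJ : g J = x)
    (hstep : ∀ i < J, g i ≤ g (i + 1) ∧ g (i + 1) - g i ≤ Δ) :
    primeAPError x q ≤
      ∑ i ∈ range (J + 1), (⨆ a : (ZMod q)ˣ, |LevelOfDistribution.chebyshevPsiMod q a (g i) - g i / Nat.totient q|) +
        (2 * Y + Δ) / Nat.totient q := by
  haveI : NeZero q := ⟨hq⟩
  haveI : Nonempty (Set.Icc (1 : ℝ) x) := ⟨⟨1, le_rfl, hx⟩⟩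
  have hφ : (0 : ℝ) < Nat.totient q := by exact_mod_cast Nat.totient_pos.mpr (Nat.pos_of_ne_zero hq)
  refine ciSup_le fun y => ciSup_le fun a => ?_
  refine (abs_chebyshevPsiMod_sub_div_le_sum_grid (a : ZMod q) hφ hY hΔ g J hg0 hgJ hstep
    (zero_le_one.trans y.2.1) y.2.2).trans (add_le_add (Finset.sum_le_sum fun i _ => ?_) le_rfl)
  exact le_ciSup (f := fun b : (ZMod q)ˣ => |LevelOfDistribution.chebyshevPsiMod q b (g i) - g i / Nat.totient q|)
    (Set.finite_range _).bddAbove a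

/-! ### `∑_{q ≤ Q} 1/φ(q) ≤ (1 + log Q)²` -/

/-- `q ≤ φ(q) τ(q)` (from `q = ∑_{d ∣ q} φ(d)` and `φ(d) ≤ φ(q)` for `d ∣ q`). [folklore] -/
private theorem self_le_totient_mul_card_divisors' (q : ℕ) :
    q ≤ Nat.totient q * q.divisors.card := by
  rcases Nat.eq_zero_or_pos q with rfl | hq
  · simp
  calc q = ∑ d ∈ q.divisors, Nat.totient d := (Nat.sum_totient q).symm
    _ ≤ ∑ d ∈ q.divisors, Nat.totient q := sum_le_sum fun d hd =>
        Nat.le_of_dvd (Nat.totient_pos.mpr hq) (Nat.totient_dvd_of_dvd (Nat.dvd_of_mem_divisors hd))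
    _ = _ := by rw [sum_const, smul_eq_mul, mul_comm]

/-- `∑_{1 ≤ q ≤ Q} 1/φ(q) ≤ (1 + log Q)²` (via `1/φ(q) ≤ τ(q)/q` and `∑_{q ≤ Q} τ(q)/q ≤ H_Q²`; a sharper
`≪ log Q` holds but is not needed). [folklore] -/
theorem sum_Icc_one_div_totient_le_sq (Q : ℕ) :
    ∑ q ∈ Icc 1 Q, (1 : ℝ) / Nat.totient q ≤ (1 + Real.log Q) ^ 2 := by
  have h1 : ∑ q ∈ Icc 1 Q, (1 : ℝ) / Nat.totient q ≤ ∑ q ∈ Icc 1 Q, (q.divisors.card : ℝ) / q := by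
    refine sum_le_sum fun q hq => ?_
    have hq1 : 1 ≤ q := (mem_Icc.mp hq).1
    have hφ : (0 : ℝ) < Nat.totient q := by exact_mod_cast Nat.totient_pos.mpr hq1
    have hq0 : (0 : ℝ) < q := by exact_mod_cast hq1
    rw [div_le_div_iff₀ hφ hq0, one_mul, mul_comm]
    exact_mod_cast self_le_totient_mul_card_divisors' q
  have h2 : ∑ q ∈ Icc 1 Q, (q.divisors.card : ℝ) / q ≤ (∑ d ∈ Icc 1 Q, (1 : ℝ) / d) ^ 2 := by
    simpa [sq, Finset.sum_const, nsmul_eq_mul, one_div] using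
      sum_sum_divisors_div_le (fun _ => (1 : ℝ)) (fun _ => zero_le_one) Q
  have h0 : 0 ≤ ∑ d ∈ Icc 1 Q, (1 : ℝ) / d := sum_nonneg fun d _ => by positivity
  calc _ ≤ _ := h1
    _ ≤ _ := h2
    _ ≤ _ := pow_le_pow_left₀ h0 (sum_Icc_one_div_le_one_add_log Q) 2


/-! ### Wave0 `EH θ` for all `θ < 1` implies the prelude `ElliottHalberstam` -/

/-- The Wave0 `EH` summand `max_{(a,q)=1} |ψ(y; q, a) − y/φ(q)|` is nonnegative. [folklore] -/
theorem iSup_abs_chebyshevPsiMod_sub_nonneg (q : ℕ) (y : ℝ) :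
    0 ≤ ⨆ a : (ZMod q)ˣ, |LevelOfDistribution.chebyshevPsiMod q a y - y / Nat.totient q| :=
  Real.iSup_nonneg fun _ => abs_nonneg _

/-- **From the `y = x` form to the `max_{y ≤ x}` form of the level of distribution.** If the Wave0
hypothesis `EH θ'` (`∑_{q ≤ y^{θ'}} max_a |ψ(y; q, a) − y/φ(q)| ≪_{A} y (log y)^{−A}` for every real `A`)
holds for every `θ' < 1`, then the primes have level `x^θ` in the Bombieri–Vinogradov shape
(`PrimesHaveLevel θ`: with the inner `max_{1 ≤ y ≤ x}`) for every `θ < 1`.  Grid argument: see the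
module docstring (`Y = Δ = x (log x)^{−(A+2)}`, `J + 1 ≤ 3 (log x)^{A+2}` grid points, `EH θ'` with
`θ' = max ((θ+1)/2) (1/2)` and exponent `2A + 4` at each of them, `∑_{q ≤ Q} 1/φ(q) ≤ (1 + log Q)²`).
[cite: IwaniecKowalski2004, §17.1] -/
theorem primesHaveLevel_of_forall_eh (hEH : ∀ θ : ℝ, θ < 1 → Literature.NumberTheory.Sieve.EH θ) {θ : ℝ}
    (hθ : θ < 1) : PrimesHaveLevel θ := by
  intro A hA ε hε
  -- parameters
  set η : ℝ := θ - ε with hη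
  set θ' : ℝ := max ((θ + 1) / 2) (1 / 2) with hθ'
  have hθ'1 : θ' < 1 := max_lt (by linarith) (by norm_num)
  have hθ'0 : 0 < θ' := lt_of_lt_of_le (by norm_num) (le_max_right _ _)
  have hgap : 0 < θ' - η := by
    have : (θ + 1) / 2 ≤ θ' := le_max_left _ _
    rw [hη]; linarith
  set B : ℝ := A + 2 with hB
  have hB0 : 0 < B := by linarith
  set A₁ : ℝ := A + B with hA₁
  have hA₁0 : 0 < A₁ := by linarith
  -- `EH θ'` with exponent `A₁`, made explicit
  obtain ⟨C₁, hC₁0, hC₁⟩ := (hEH θ' hθ'1 A₁).exists_nonneg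
  obtain ⟨y₀, hy₀⟩ := eventually_atTop.1 hC₁.bound
  -- eventual conditions on `u = log x`
  set κ : ℝ := min (1 / (2 * B)) ((θ' - η) / (θ' * B)) with hκ
  have hκ0 : 0 < κ := lt_min (by positivity) (div_pos hgap (by positivity))
  have hu : ∀ᶠ u : ℝ in atTop, 1 ≤ u ∧ 2 * max (Real.log y₀) 0 ≤ u ∧ Real.log u ≤ κ * u := by
    filter_upwards [eventually_ge_atTop (1 : ℝ), eventually_ge_atTop (2 * max (Real.log y₀) 0),
      Real.isLittleO_log_id_atTop.bound hκ0] with u hu1 hu2 hu3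
    refine ⟨hu1, hu2, ?_⟩
    rw [Real.norm_of_nonneg (Real.log_nonneg hu1), id, Real.norm_of_nonneg (by linarith)] at hu3
    exact hu3
  refine IsBigO.of_bound (3 * C₁ * 2 ^ A₁ + 12) ?_
  filter_upwards [Real.tendsto_log_atTop.eventually hu, eventually_gt_atTop (0 : ℝ)] with x hx hx0
  obtain ⟨hu1, hu2, hu3⟩ := hx
  set u : ℝ := Real.log x with hu_def
  have hx1 : 1 ≤ x := by
    by_contra h
    have := Real.log_nonpos hx0.le (not_le.1 h).le
    linarith
  have hBlog : B * Real.log u ≤ u / 2 := by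
    have h1 : κ ≤ 1 / (2 * B) := min_le_left _ _
    calc B * Real.log u ≤ B * (κ * u) := mul_le_mul_of_nonneg_left hu3 hB0.le
      _ ≤ B * (1 / (2 * B) * u) := by gcongr
      _ = u / 2 := by field_simp
  have hθlog : θ' * B * Real.log u ≤ (θ' - η) * u := by
    have h1 : κ ≤ (θ' - η) / (θ' * B) := min_le_right _ _
    calc θ' * B * Real.log u ≤ θ' * B * (κ * u) := mul_le_mul_of_nonneg_left hu3 (by positivity)
      _ ≤ θ' * B * ((θ' - η) / (θ' * B) * u) := by gcongr
      _ = (θ' - η) * u := by field_simp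
  -- `Y = x / (log x)^B`
  have huB : 1 ≤ u ^ B := Real.one_le_rpow hu1 hB0.le
  have hu0 : 0 < u := by linarith
  have huB0 : 0 < u ^ B := Real.rpow_pos_of_pos hu0 B
  set Y : ℝ := x / u ^ B with hY
  have hY0 : 0 < Y := div_pos hx0 huB0
  have hYx : Y ≤ x := div_le_self hx0.le huB
  have hlogY : Real.log Y = u - B * Real.log u := by
    rw [hY, Real.log_div hx0.ne' huB0.ne', Real.log_rpow hu0]
  have hlogY2 : u / 2 ≤ Real.log Y := by rw [hlogY]; linarith
  have hlogY0 : 0 < Real.log Y := by linarith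
  have hY1 : 1 < Y := by
    by_contra h
    have := Real.log_nonpos hY0.le (not_lt.1 h)
    linarith
  have hYy₀ : y₀ ≤ Y := by
    by_cases hy : y₀ ≤ 0
    · linarith
    · have h1 : Real.log y₀ ≤ max (Real.log y₀) 0 := le_max_left _ _
      have h2 : Real.log y₀ ≤ Real.log Y := by linarith
      exact (Real.log_le_log_iff (not_le.1 hy) hY0).1 h2
  -- the level: `Q = ⌊x^η⌋ ≤ Y^{θ'}`
  set Q : ℕ := ⌊x ^ η⌋₊ with hQ
  have hxη : x ^ η ≤ Y ^ θ' := by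
    rw [Real.rpow_def_of_pos hx0, Real.rpow_def_of_pos hY0, Real.exp_le_exp, hlogY, ← hu_def]
    linarith
  -- the grid `g i = min x ((i + 1) Y)`, `0 ≤ i ≤ J = ⌈u^B⌉`
  set J : ℕ := ⌈u ^ B⌉₊ with hJ
  set g : ℕ → ℝ := fun i => min x ((i + 1) * Y) with hg
  have hg0 : g 0 = Y := by
    show min x ((((0 : ℕ) : ℝ) + 1) * Y) = Y
    rw [Nat.cast_zero, zero_add, one_mul, min_eq_right hYx]
  have hgJ : g J = x := by
    show min x ((((J : ℕ) : ℝ) + 1) * Y) = x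
    refine min_eq_left ?_
    have h1 : u ^ B ≤ J := Nat.le_ceil _
    calc x = u ^ B * Y := by rw [hY]; field_simp
      _ ≤ ((J : ℝ) + 1) * Y := by gcongr; linarith
  have hstep : ∀ i < J, g i ≤ g (i + 1) ∧ g (i + 1) - g i ≤ Y := by
    intro i _
    show min x ((((i : ℕ) : ℝ) + 1) * Y) ≤ min x (((((i + 1 : ℕ)) : ℝ) + 1) * Y) ∧
      min x (((((i + 1 : ℕ)) : ℝ) + 1) * Y) - min x ((((i : ℕ) : ℝ) + 1) * Y) ≤ Y
    push_cast
    have hle : ((i : ℝ) + 1) * Y ≤ ((i : ℝ) + 1 + 1) * Y := by nlinarith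
    refine ⟨min_le_min_left _ hle, ?_⟩
    rcases le_total x (((i : ℝ) + 1) * Y) with h | h
    · rw [min_eq_left h, min_eq_left (h.trans hle)]; linarith
    · rw [min_eq_right h]
      have := min_le_right x (((i : ℝ) + 1 + 1) * Y)
      nlinarith
  have hgY : ∀ i, Y ≤ g i := fun i => by
    show Y ≤ min x ((((i : ℕ) : ℝ) + 1) * Y)
    refine le_min hYx ?_
    have : (0 : ℝ) ≤ (i : ℕ) := Nat.cast_nonneg i
    nlinarith
  have hgx : ∀ i, g i ≤ x := fun i => min_le_left _ _
  -- `EH θ'` at each grid point, for the moduli `q ≤ Q`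
  have hEHi : ∀ i, ∑ q ∈ Icc 1 Q,
      (⨆ a : (ZMod q)ˣ, |LevelOfDistribution.chebyshevPsiMod q a (g i) - g i / Nat.totient q|) ≤
        C₁ * (2 ^ A₁ * (x / u ^ A₁)) := by
    intro i
    have hgi0 : 0 < g i := hY0.trans_le (hgY i)
    have hlgi : Real.log Y ≤ Real.log (g i) := Real.log_le_log hY0 (hgY i)
    have hlgi0 : 0 < Real.log (g i) := hlogY0.trans_le hlgi
    have hQi : Q ≤ ⌊g i ^ θ'⌋₊ :=
      Nat.floor_le_floor (hxη.trans (Real.rpow_le_rpow hY0.le (hgY i) hθ'0.le))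
    have h1 := hy₀ (g i) (hYy₀.trans (hgY i))
    rw [chebyshevPsiMod_eq_wave0,
      Real.norm_of_nonneg (Finset.sum_nonneg fun q _ => iSup_abs_chebyshevPsiMod_sub_nonneg q _),
      Real.norm_of_nonneg (div_nonneg hgi0.le (Real.rpow_nonneg hlgi0.le _))] at h1
    calc ∑ q ∈ Icc 1 Q, (⨆ a : (ZMod q)ˣ, |LevelOfDistribution.chebyshevPsiMod q a (g i) - g i / Nat.totient q|)
        ≤ ∑ q ∈ Icc 1 ⌊g i ^ θ'⌋₊,
            (⨆ a : (ZMod q)ˣ, |LevelOfDistribution.chebyshevPsiMod q a (g i) - g i / Nat.totient q|) :=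
          Finset.sum_le_sum_of_subset_of_nonneg (Finset.Icc_subset_Icc le_rfl hQi)
            fun q _ _ => iSup_abs_chebyshevPsiMod_sub_nonneg q _
      _ ≤ C₁ * (g i / Real.log (g i) ^ A₁) := h1
      _ ≤ C₁ * (2 ^ A₁ * (x / u ^ A₁)) := by
          refine mul_le_mul_of_nonneg_left ?_ hC₁0
          have h2 : (u / 2) ^ A₁ ≤ Real.log (g i) ^ A₁ :=
            Real.rpow_le_rpow (by linarith) (hlogY2.trans hlgi) hA₁0.le
          have h3 : 0 < (u / 2) ^ A₁ := Real.rpow_pos_of_pos (by linarith) _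
          calc g i / Real.log (g i) ^ A₁ ≤ x / (u / 2) ^ A₁ := by gcongr; exact hgx i
            _ = 2 ^ A₁ * (x / u ^ A₁) := by
                rw [Real.div_rpow hu0.le (by norm_num : (0 : ℝ) ≤ 2)]
                have h4 : (0 : ℝ) < 2 ^ A₁ := Real.rpow_pos_of_pos (by norm_num) _
                have h5 : 0 < u ^ A₁ := Real.rpow_pos_of_pos hu0 _
                field_simp
  -- `∑_{q ≤ Q} 1/φ(q) ≤ (2 log x)²`
  have hφsum : ∑ q ∈ Icc 1 Q, (1 : ℝ) / Nat.totient q ≤ (2 * u) ^ 2 := by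
    refine (sum_Icc_one_div_totient_le_sq Q).trans ?_
    have hQx : Real.log Q ≤ u := by
      rcases Nat.eq_zero_or_pos Q with h0 | hpos
      · rw [h0, Nat.cast_zero, Real.log_zero]; linarith
      · rw [hu_def]
        refine Real.log_le_log (by exact_mod_cast hpos) ?_
        calc (Q : ℝ) ≤ x ^ η := Nat.floor_le (Real.rpow_nonneg hx0.le _)
          _ ≤ x ^ (1 : ℝ) := Real.rpow_le_rpow_of_exponent_le hx1 (by rw [hη]; linarith)
          _ = x := Real.rpow_one x
    have h0 : 0 ≤ 1 + Real.log Q := by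
      have := Real.log_natCast_nonneg Q
      linarith
    exact pow_le_pow_left₀ h0 (by linarith) 2
  -- each `E*(x; q)` through the grid
  have hq_bound : ∀ q ∈ Icc 1 Q, primeAPError x q ≤
      ∑ i ∈ range (J + 1), (⨆ a : (ZMod q)ˣ, |LevelOfDistribution.chebyshevPsiMod q a (g i) - g i / Nat.totient q|) +
        (2 * Y + Y) / Nat.totient q := by
    intro q hq
    have hq0 : q ≠ 0 := by have := (Finset.mem_Icc.1 hq).1; omega
    exact primeAPError_le_sum_grid hq0 hx1 hY0.le hY0.le g J hg0 hgJ hstep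
  have hJ3 : (J : ℝ) + 1 ≤ 3 * u ^ B := by
    have : (J : ℝ) < u ^ B + 1 := Nat.ceil_lt_add_one huB0.le
    linarith
  have e1 : u ^ B * (x / u ^ A₁) = x / u ^ A := by
    have h1 : u ^ A₁ = u ^ A * u ^ B := by rw [hA₁, Real.rpow_add hu0]
    have huA : 0 < u ^ A := Real.rpow_pos_of_pos hu0 A
    rw [h1]
    field_simp
  have e2 : x / u ^ B * u ^ 2 = x / u ^ A := by
    have h2 : u ^ B = u ^ A * u ^ 2 := by rw [hB, Real.rpow_add hu0, Real.rpow_two]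
    have huA : 0 < u ^ A := Real.rpow_pos_of_pos hu0 A
    rw [h2]
    field_simp
  have hmain : ∑ q ∈ Icc 1 Q, primeAPError x q ≤ (3 * C₁ * 2 ^ A₁ + 12) * (x / u ^ A) := by
    calc ∑ q ∈ Icc 1 Q, primeAPError x q
        ≤ ∑ q ∈ Icc 1 Q, (∑ i ∈ range (J + 1),
            (⨆ a : (ZMod q)ˣ, |LevelOfDistribution.chebyshevPsiMod q a (g i) - g i / Nat.totient q|) +
              (2 * Y + Y) / Nat.totient q) := Finset.sum_le_sum hq_bound
      _ = ∑ i ∈ range (J + 1), ∑ q ∈ Icc 1 Q,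
            (⨆ a : (ZMod q)ˣ, |LevelOfDistribution.chebyshevPsiMod q a (g i) - g i / Nat.totient q|) +
            3 * Y * ∑ q ∈ Icc 1 Q, (1 : ℝ) / Nat.totient q := by
          rw [Finset.sum_add_distrib, Finset.sum_comm, Finset.mul_sum]
          congr 1
          exact Finset.sum_congr rfl fun q _ => by ring
      _ ≤ ∑ i ∈ range (J + 1), C₁ * (2 ^ A₁ * (x / u ^ A₁)) + 3 * Y * (2 * u) ^ 2 := by
          gcongr with i
          · exact hEHi i
      _ = ((J : ℝ) + 1) * (C₁ * (2 ^ A₁ * (x / u ^ A₁))) + 12 * (x / u ^ B * u ^ 2) := by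
          rw [Finset.sum_const, Finset.card_range, nsmul_eq_mul]
          push_cast
          rw [hY]; ring
      _ ≤ 3 * u ^ B * (C₁ * (2 ^ A₁ * (x / u ^ A₁))) + 12 * (x / u ^ B * u ^ 2) := by
          gcongr
      _ = 3 * C₁ * 2 ^ A₁ * (u ^ B * (x / u ^ A₁)) + 12 * (x / u ^ B * u ^ 2) := by ring
      _ = (3 * C₁ * 2 ^ A₁ + 12) * (x / u ^ A) := by rw [e1, e2]; ring
  rw [Real.norm_of_nonneg (Finset.sum_nonneg fun q _ => primeAPError_nonneg x q),
    Real.norm_of_nonneg (div_nonneg hx0.le (Real.rpow_nonneg hu0.le A))]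
  exact hmain

/-- `ElliottHalberstamConjecture` (Wave0, parity.S25) implies `ElliottHalberstam` (prelude).
[cite: IwaniecKowalski2004, §17.1] -/
theorem elliottHalberstam_of_wave0 (h : Literature.NumberTheory.Sieve.ElliottHalberstamConjecture) : LevelOfDistribution.ElliottHalberstam :=
  fun _ hθ => primesHaveLevel_of_forall_eh h hθ

/-! ### The prelude `ElliottHalberstam` implies Wave0 `EH θ` for all `θ < 1` -/

/-- **From the `max_{y ≤ x}` form to the `y = x` form.** If the primes have level `x^{θ₁}` in the
Bombieri–Vinogradov shape for every `θ₁ < 1`, then `EH θ` holds for every `θ < 1`: apply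
`PrimesHaveLevel ((θ+1)/2)` with `ε = (1−θ)/2` and `A' = max A 1`; the summand
`max_a |ψ(x; q, a) − x/φ(q)|` is the `y = x` term of `E*(x; q)`, and `x (log x)^{−A'} ≤ x (log x)^{−A}`
for `log x ≥ 1`. [cite: IwaniecKowalski2004, §17.1] -/
theorem LevelOfDistribution.ElliottHalberstam.eh (h : LevelOfDistribution.ElliottHalberstam) {θ : ℝ} (hθ : θ < 1) : Literature.NumberTheory.Sieve.EH θ := by
  intro A
  set θ₁ : ℝ := (θ + 1) / 2 with hθ₁
  have hθ₁1 : θ₁ < 1 := by rw [hθ₁]; linarith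
  have hε : 0 < θ₁ - θ := by rw [hθ₁]; linarith
  have hlev := h θ₁ hθ₁1 (max A 1) (lt_of_lt_of_le zero_lt_one (le_max_right A 1)) (θ₁ - θ) hε
  have hθeq : θ₁ - (θ₁ - θ) = θ := by ring
  rw [hθeq] at hlev
  refine IsBigO.trans (IsBigO.of_bound 1 ?_) (hlev.trans (IsBigO.of_bound 1 ?_))
  · filter_upwards [eventually_ge_atTop (1 : ℝ)] with x hx
    haveI : Nonempty (Set.Icc (1 : ℝ) x) := ⟨⟨x, hx, le_rfl⟩⟩
    rw [one_mul, chebyshevPsiMod_eq_wave0,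
      Real.norm_of_nonneg (Finset.sum_nonneg fun q _ => iSup_abs_chebyshevPsiMod_sub_nonneg q _),
      Real.norm_of_nonneg (Finset.sum_nonneg fun q _ => primeAPError_nonneg x q)]
    refine Finset.sum_le_sum fun q hq => ?_
    have hq0 : q ≠ 0 := by have := (Finset.mem_Icc.1 hq).1; omega
    exact le_ciSup_of_le (bddAbove_range_primeAPError x q hq0) ⟨x, hx, le_rfl⟩ le_rfl
  · filter_upwards [eventually_ge_atTop (Real.exp 1)] with x hx
    have hx0 : 0 < x := (Real.exp_pos 1).trans_le hx
    have hlog : 1 ≤ Real.log x := by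
      rw [← Real.log_exp 1]; exact Real.log_le_log (Real.exp_pos 1) hx
    have hl0 : 0 < Real.log x := by linarith
    rw [one_mul, Real.norm_of_nonneg (div_nonneg hx0.le (Real.rpow_nonneg hl0.le _)),
      Real.norm_of_nonneg (div_nonneg hx0.le (Real.rpow_nonneg hl0.le _))]
    gcongr
    exact le_max_left A 1

/-- **Discharge of `Literature.NumberTheory.Sieve.elliottHalberstam_iff_wave0`.** The prelude form
`ElliottHalberstam = ∀ θ < 1, PrimesHaveLevel θ` (Bombieri–Vinogradov shape with `max_{y ≤ x}`, `ε`-slack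
in the level, `A > 0`) and the Wave0 form `Literature.Parity.ElliottHalberstamConjecture = ∀ θ < 1, EH θ`
(parity.S25: `y = x`, level exactly `x^θ`, all real `A`) of the Elliott–Halberstam conjecture are
equivalent (`ElliottHalberstam.eh`, `primesHaveLevel_of_forall_eh`). [cite: IwaniecKowalski2004, §17.1] -/
theorem elliottHalberstam_iff_wave0_holds : elliottHalberstam_iff_wave0 :=
  ⟨fun h _ hθ => h.eh hθ, elliottHalberstam_of_wave0⟩

end Literature.NumberTheory.Sieve
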